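import Literature.MathematicalPhysics.QuantumLattice.GroundStateLocalCertificateKKT
import Literature.MathematicalPhysics.QuantumLattice.DWaveSourceNNNHoppingWindowCertificate
import Literature.MathematicalPhysics.QuantumLattice.DWaveSourceNNNHoppingOrderParameter
import HarnessLib

/-!
# Window (translation-invariant) one-point certificates WITH state-optimality blocks for the
# pair-sourced `t–t'` Hubbard torus: `c − Σ‖a‖ ≤ 2·m_L(h)` on EVERY large torus

Topic `Literature/MathematicalPhysics/QuantumLattice`. Everything here is PROVED; no definition and no
named fact is introduced. Companion of `DWaveSourceNNNHoppingWindowCertificate` (window identity with an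
ENERGY constraint ⇒ orbit-state expectation of a local observable in every eigenvector of the sourced torus)
and of `GroundStateLocalCertificateKKT` (local certificates with a KKT block in the tracial ground state).

WHAT IS ADDED: the second-order STATE-OPTIMALITY ("KKT") block of Araújo et al. (2023, Prop. 11) /
Fawzi–Fawzi–Scalet (2024, §2) computed IN THE WINDOW, `kktForm H^{src,tt'}_{Λ'} G (Γ(incl) ∘ B)` with
`H^{src,tt'}_{Λ'} = pairSourceWindowHamiltonianTT' dWaveFormFactor Λ' tp U μ h`, `G ⪰ 0` and generators
`B_b ∈ 𝔄_Λ` in the inner region — ARBITRARY words (charged pair words `Φ_x`, odd words `c`, `c†c c`, …: the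
sourced Hamiltonian conserves no particle number, so no chemical-potential licence is involved). It pulls
back along `x ↦ x mod L` to the KKT block of `A_L = dWaveSourceTorusTT' L tp U μ h` (locality,
`dWaveSourceTorusTT'_commutator_fermionEmbed`; `fermionEmbed_kktForm_of_commutator`), which is `≥ 0` in the
TRACIAL ground state `ω₀` of `A_L` (`groundStateFunctional_kktForm_nonneg`). Hence ONE identity in `𝔄_{Λ'}`

  `X − c·1 − κ (u·1 − E^{src,tt'}) = Σ Λₐᵦ Oₐᴴ O_b + (Σₖ [H^{src,tt'}_{Λ'}, Γ(incl)Bₖ]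
      + Σₗ (Γ(incl)(Γ(d4Emb γₗ vₗ) Yₗ) − Γ(incl) Yₗ) + Σⱼ bⱼ wⱼ)
      + (kktForm H^{src,tt'}_{Λ'} G (Γ(incl) ∘ B) + (Σₘ dₘ (Vₘᴴ − Vₘ) + Σₖ aₖ vₖ))`

(`χ_{B₁g}(γₗ) = 1`, `S^z`-charged ladder words `wⱼ`, real `dₘ`, ladder words `vₖ`) gives, for every `L ≥ 3`
with `x ↦ x mod L` injective on `thicken Λ' 1`, `c − Σₖ ‖aₖ‖ + κ (u − E₀(A_L)/L²) ≤ Re ω₀(Γ(ι_{Λ',L}) X)`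
(`re_groundStateFunctional_ge_of_sourced_window_certificate_kkt_d4_TT'`), and for the ONE-POINT RESPONSE
objective `X = Γ(incl) Φ₀ + (Γ(incl) Φ₀)ᴴ` (`Φ₀ = localPairAt {0,±e₁,±e₂} dWaveFormFactor 0`), in the
CONVENTION OF RECORD `m_L(h) = dWaveSourceDensityTT' L tp U μ h = Re ω₀(Δ_d)/L²` (half of Koma–Tasaki's `m`),
`c − Σₖ ‖aₖ‖ + κ (u − E₀(A_L)/L²) ≤ 2 · m_L(h)` (`two_mul_dWaveSourceDensityTT'_ge_of_window_certificate_kkt_d4`);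
with `κ ≥ 0` and a sourced energy cap on all large tori, eventually in `L`
(`dWaveSourceDensityTT'_ge_of_window_certificate_kkt_d4_eventually` — the `∀ L ≥ L₀` shape of the
hubbard-obs pinning-field response FLOOR rows; without energy rows take `κ = 0`).

Honest framing (hubbard-cq wording W1): a finite-`h` response floor is a «finite-h response (certified)»
row, NOT an order parameter and NOT a phase word; finitely many such rows imply nothing about
`dWaveOrderParameterTT'` (barrier `SourcedResponseEpsilonLift`). Rows of the grand-canonical sourced
Hamiltonian at FIXED `μ`. No certificate exists in this file: soundness edge of crux K2 of card
`sourced-kkt-one-point-floor` (cell hubbard-cq).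

## References
* J. Wang et al., Phys. Rev. X 14 (2024) 031006, §III, §VI. [cite: WangEtAl2024, §III]
* M. Araújo et al., arXiv:2311.18707, §3.2 Prop. 11. [cite: AraujoEtAl2023, §3.2 Prop. 11]
* X. Han, arXiv:2006.06002 (2020), §3 (window / thermodynamic-limit fermionic bootstrap). [cite: Han2020Bootstrap, §3]
* T. Koma, H. Tasaki, J. Stat. Phys. 76 (1994) 745, §1. [cite: KomaTasaki1994, §1]
* O. Bratteli, D. W. Robinson II (1997), Prop. 5.3.19, §6.2.4. [cite: BratteliRobinsonII1997, §6.2.4]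
-/

noncomputable section

namespace Literature.MathematicalPhysics.QuantumLattice

open Matrix Finset HubbardWave0 Literature.Probability.LatticeModels
open Literature.MathematicalPhysics.QuantumManyBody.StateRelaxation
open scoped ComplexOrder BigOperators

/-! ### Pull-back of a window KKT block along a `*`-homomorphism -/

section Embedding

variable {Λ Λ' : Type*} [LinearOrder Λ] [Fintype Λ] [LinearOrder Λ'] [Fintype Λ']

/-- **A window KKT block pulls back to a KKT block of the big Hamiltonian**: if `Γ(φ)` carries the window
commutators `[h_w, B_b]` to `[H, Γ(φ) B_b]` (locality), then `Γ(φ)(kktForm h_w G B) = kktForm H G (Γ(φ) ∘ B)`.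
[cite: Han2020Bootstrap, §3] [cite: AraujoEtAl2023, §3.2 Prop. 11] -/
theorem fermionEmbed_kktForm_of_commutator (φ : Λ ↪ Λ')
    (hw : Matrix (Finset (Orb Λ)) (Finset (Orb Λ)) ℂ) (H : Matrix (Finset (Orb Λ')) (Finset (Orb Λ')) ℂ)
    {β : Type*} [Fintype β] (G : Matrix β β ℂ) (B : β → Matrix (Finset (Orb Λ)) (Finset (Orb Λ)) ℂ)
    (hloc : ∀ j, fermionEmbed φ (hw * B j - B j * hw) =
      H * fermionEmbed φ (B j) - fermionEmbed φ (B j) * H) :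
    fermionEmbed φ (kktForm hw G B) = kktForm H G (fun j => fermionEmbed φ (B j)) := by
  unfold kktForm
  rw [fermionEmbed_sum]
  refine Finset.sum_congr rfl fun i _ => ?_
  rw [fermionEmbed_sum]
  refine Finset.sum_congr rfl fun j _ => ?_
  rw [fermionEmbed_smul, fermionEmbed_mul, ← hloc j, Matrix.star_eq_conjTranspose,
    Matrix.star_eq_conjTranspose, fermionEmbed_conjTranspose]

end Embedding

/-! ### The window certificate with a KKT block, read in the tracial ground state -/

section Certificate

variable {L : ℕ} [NeZero L]

-- Torus sites are compared through the linear order inside this section — the instance the torus files'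
-- lemmas are built with (`DWaveSourceNNNHoppingWindowCertificate`'s section-local instance, re-activated
-- here; no new declaration). The instance-independent consumer form is `…_eventually` below.
attribute [local instance 10000] instDecidableEqFermionTorusSrcTTWindow

/-- **Window certificate with an energy term, affine `D₄` reductions AND a state-optimality block ⇒
tracial ground-state expectation of a local observable on EVERY large pair-sourced `t–t'` torus** (data and
identity as in the module docstring; `B_b ∈ 𝔄_Λ` ANY words): for every `L ≥ 3` with `x ↦ x mod L`
injective on `thicken Λ' 1`, `c − Σₖ ‖aₖ‖ + κ (u − E₀(A_L)/L²) ≤ Re ω₀(Γ(ι_{Λ',L}) X)`, `ω₀` the tracial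
ground state of `A_L = dWaveSourceTorusTT' L tp U μ h` on the full Fock space. [cite: WangEtAl2024, §III]
[cite: AraujoEtAl2023, §3.2 Prop. 11] [cite: Han2020Bootstrap, §3] -/
theorem re_groundStateFunctional_ge_of_sourced_window_certificate_kkt_d4_TT' (tp U μ h : ℝ) (hL : 3 ≤ L)
    {Λ Λ' : Finset (Site 2)} (hΛ : Λ ⊆ Λ') (h8 : thicken Λ 1 ⊆ Λ')
    (h0 : thicken ({0} : Finset (Site 2)) 1 ⊆ Λ') (hz : (0 : Site 2) ∈ Λ')
    (hP : pairRegion (insert (0 : Site 2) unitSteps) 0 ⊆ Λ')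
    (hInj : Set.InjOn (Torus.proj (d := 2) L) ↑(thicken Λ' 1))
    (hInj' : Set.InjOn (Torus.proj (d := 2) L) ↑Λ')
    (Xw : FermionOp Λ') (κ u : ℝ)
    {m : Type*} [Fintype m] [DecidableEq m] {Λm : Matrix m m ℂ} (hΛm : Λm.PosSemidef)
    (O : m → FermionOp Λ')
    {κ' : Type*} (s : Finset κ') (B : κ' → FermionOp Λ)
    {ι : Type*} (tt : Finset ι) (gam : ι → DihedralGroup 4) (v : ι → Site 2)
    (hgam : ∀ l ∈ tt, b1gChar (gam l) = 1) (hsh : ∀ l, d4ShiftSet (gam l) (v l) Λ ⊆ Λ') (Y : ι → FermionOp Λ)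
    {χ : Type*} (uu : Finset χ) (b : χ → ℂ) (cw : χ → List (Orb (PolySite Λ') × Bool))
    (hcw : ∀ j ∈ uu, ladderSpinCharge (cw j) ≠ 0)
    {β : Type*} [Fintype β] [DecidableEq β] {G : Matrix β β ℂ} (hG : G.PosSemidef) (Bk : β → FermionOp Λ)
    {δ : Type*} (ah : Finset δ) (dc : δ → ℝ) (V : δ → FermionOp Λ')
    {κ'' : Type*} (w : Finset κ'') (a : κ'' → ℂ) (word : κ'' → List (Orb (PolySite Λ') × Bool)) {c : ℝ}
    (hcert : Xw - (c : ℂ) • (1 : FermionOp Λ') -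
        ((κ : ℝ) : ℂ) • (((u : ℝ) : ℂ) • (1 : FermionOp Λ') -
          (fermionEmbed (PolySite.incl h0) ((hubbardTTPrimeFermionInteraction 1 tp U).meanEnergyObs 1) -
            (μ : ℂ) • ∑ σ : Fin 2, nAt 0 hz σ -
            (h : ℂ) • (fermionEmbed (PolySite.incl hP) (localPairAt (insert (0 : Site 2) unitSteps) dWaveFormFactor 0) +
              (fermionEmbed (PolySite.incl hP) (localPairAt (insert (0 : Site 2) unitSteps) dWaveFormFactor 0))ᴴ))) =
      gramForm Λm O +
        (∑ k ∈ s, (pairSourceWindowHamiltonianTT' dWaveFormFactor Λ' tp U μ h * fermionEmbed (PolySite.incl hΛ) (B k) -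
            fermionEmbed (PolySite.incl hΛ) (B k) * pairSourceWindowHamiltonianTT' dWaveFormFactor Λ' tp U μ h) +
          ∑ l ∈ tt, (fermionEmbed (PolySite.incl (hsh l)) (fermionEmbed (PolySite.d4Emb (gam l) (v l) Λ) (Y l)) -
            fermionEmbed (PolySite.incl hΛ) (Y l)) +
          ∑ j ∈ uu, b j • ladderWord (cw j)) +
        (kktForm (pairSourceWindowHamiltonianTT' dWaveFormFactor Λ' tp U μ h) G
            (fun i => fermionEmbed (PolySite.incl hΛ) (Bk i)) +
          (∑ m' ∈ ah, ((dc m' : ℝ) : ℂ) • ((V m')ᴴ - V m') + ∑ k ∈ w, a k • ladderWord (word k)))) :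
    c - ∑ k ∈ w, ‖a k‖ + κ * (u - (dWaveSourceTorusTT' L tp U μ h).groundEnergy / (L : ℝ) ^ 2) ≤
      ((dWaveSourceTorusTT' L tp U μ h).groundStateFunctional
        (fermionEmbed (PolySite.toTorusEmb L hInj') Xw)).re := by
  classical
  have hInjΛ : Set.InjOn (Torus.proj (d := 2) L) ↑Λ := hInj'.mono (by exact_mod_cast hΛ)
  set Γ' := fermionEmbed (PolySite.toTorusEmb L hInj') with hΓ'
  set ΓΛ := fermionEmbed (PolySite.toTorusEmb L hInjΛ) with hΓΛ
  set H := dWaveSourceTorusTT' L tp U μ h with hH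
  have hHh : H.IsHermitian := dWaveSourceTorusTT'_isHermitian L tp U μ h
  -- the local energy; its torus translates sum to `A_L`
  set X := Γ' (fermionEmbed (PolySite.incl h0) ((hubbardTTPrimeFermionInteraction 1 tp U).meanEnergyObs 1) -
      (μ : ℂ) • ∑ σ : Fin 2, nAt 0 hz σ -
      (h : ℂ) • (fermionEmbed (PolySite.incl hP) (localPairAt (insert (0 : Site 2) unitSteps) dWaveFormFactor 0) +
        (fermionEmbed (PolySite.incl hP) (localPairAt (insert (0 : Site 2) unitSteps) dWaveFormFactor 0))ᴴ)) with hX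
  set T : TorusSite 2 L → Matrix (Finset (Orb (FermionTorus 2 L))) (Finset (Orb (FermionTorus 2 L))) ℂ :=
    fun v' => (fockTranslate v').val with hT
  have hTH : ∀ v', T v' * H = H * T v' := fun v' => fockTranslate_mul_dWaveSourceTorusTT' L v' tp U μ h
  have hTT : ∀ v', (T v')ᴴ * T v' = 1 := fun v' => fockTranslate_conjTranspose_mul_self v'
  have hsum : ∑ v', T v' * X * (T v')ᴴ = H := by
    rw [hH, hX, hΓ']
    exact sum_conj_fockTranslate_pairSourceObjectiveTT'_dWave L h0 hz hP hInj' hL tp U μ h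
  -- symmetry (affine `D₄`) family
  set Us : ι → Matrix (Finset (Orb (FermionTorus 2 L))) (Finset (Orb (FermionTorus 2 L))) ℂ :=
    fun l => (fockTranslate (Torus.proj L (v l))).val * (fockD4 (L := L) (gam l)).val with hUs
  set Yt : ι → Matrix (Finset (Orb (FermionTorus 2 L))) (Finset (Orb (FermionTorus 2 L))) ℂ :=
    fun l => ΓΛ (Y l) with hYt
  have hU : ∀ l ∈ tt, Us l * H = H * Us l := fun l hl =>
    d4Affine_mul_dWaveSourceTorusTT' L (gam l) (hgam l hl) _ tp U μ h
  have hUU : ∀ l ∈ tt, (Us l)ᴴ * Us l = 1 := fun l _ => d4Affine_conjTranspose_mul_self _ _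
  -- charge family: `S^z`-charged words are commutators with the conserved `S^z`
  set emb : Orb (PolySite Λ') × Bool → Orb (FermionTorus 2 L) × Bool :=
    fun p => (Orb.embMap (PolySite.toTorusEmb L hInj') p.1, p.2) with hemb
  set C : χ → Matrix (Finset (Orb (FermionTorus 2 L))) (Finset (Orb (FermionTorus 2 L))) ℂ :=
    fun _ => HubbardWave0.spinZ with hC
  set W : χ → Matrix (Finset (Orb (FermionTorus 2 L))) (Finset (Orb (FermionTorus 2 L))) ℂ :=
    fun j => (b j / (((ladderSpinCharge ((cw j).map emb) : ℤ) : ℂ) / 2)) • ladderWord ((cw j).map emb) with hW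
  have hC1 : ∀ j ∈ uu, C j * H = H * C j := fun _ _ => spinZ_mul_dWaveSourceTorusTT' L tp U μ h
  have hcharged : ∀ j ∈ uu, Γ' (b j • ladderWord (cw j)) = C j * W j - W j * C j := by
    intro j hj
    have hq : (((ladderSpinCharge ((cw j).map emb) : ℤ) : ℂ) / 2) ≠ 0 := by
      rw [hemb, ladderSpinCharge_map_embMap]
      exact div_ne_zero (Int.cast_ne_zero.2 (hcw j hj)) two_ne_zero
    rw [fermionEmbed_smul, fermionEmbed_ladderWord, hC, hW]
    simp only [Matrix.mul_smul, Matrix.smul_mul]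
    rw [← smul_sub, spinZ_comm_ladderWord, smul_smul, div_mul_cancel₀ _ hq]
  -- the KKT block pulls back to the KKT block of `A_L`
  set Bt : β → Matrix (Finset (Orb (FermionTorus 2 L))) (Finset (Orb (FermionTorus 2 L))) ℂ :=
    fun i => Γ' (fermionEmbed (PolySite.incl hΛ) (Bk i)) with hBt
  have hkkt : Γ' (kktForm (pairSourceWindowHamiltonianTT' dWaveFormFactor Λ' tp U μ h) G
      (fun i => fermionEmbed (PolySite.incl hΛ) (Bk i))) = kktForm H G Bt := by
    rw [hBt, hΓ', hH]
    exact fermionEmbed_kktForm_of_commutator _ _ _ G _ fun j =>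
      (dWaveSourceTorusTT'_commutator_fermionEmbed L hΛ h8 hInj tp U μ h (Bk j)).symm
  -- residual words are contractions
  set M : κ'' → Matrix (Finset (Orb (FermionTorus 2 L))) (Finset (Orb (FermionTorus 2 L))) ℂ :=
    fun k => ladderWord ((word k).map emb) with hM
  have hMc : ∀ k ∈ w, (M k).IsContraction := fun k _ => by
    rw [hM]; dsimp only; rw [ladderWord_eq_prod]; exact isContraction_prod_ladder _
  -- the identity, pulled back into the torus
  have htorus : Γ' Xw - (c : ℂ) • (1 : Matrix (Finset (Orb (FermionTorus 2 L))) (Finset (Orb (FermionTorus 2 L))) ℂ) -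
      ((κ : ℝ) : ℂ) • (((u : ℝ) : ℂ) •
        (1 : Matrix (Finset (Orb (FermionTorus 2 L))) (Finset (Orb (FermionTorus 2 L))) ℂ) - X) =
      gramForm Λm (fun i => Γ' (O i)) +
        (∑ k ∈ s, (H * Γ' (fermionEmbed (PolySite.incl hΛ) (B k)) - Γ' (fermionEmbed (PolySite.incl hΛ) (B k)) * H) +
          ∑ l ∈ tt, (Us l * Yt l * (Us l)ᴴ - Yt l) +
          ∑ j ∈ uu, (C j * W j - W j * C j)) +
        (kktForm H G Bt +
          (∑ m' ∈ ah, ((dc m' : ℝ) : ℂ) • ((Γ' (V m'))ᴴ - Γ' (V m')) + ∑ k ∈ w, a k • M k)) := by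
    have key := congrArg Γ' hcert
    rw [fermionEmbed_sub, fermionEmbed_sub, fermionEmbed_smul, fermionEmbed_one, fermionEmbed_smul,
      fermionEmbed_sub, fermionEmbed_smul, fermionEmbed_one] at key
    have h1 : Γ' (∑ k ∈ s, (pairSourceWindowHamiltonianTT' dWaveFormFactor Λ' tp U μ h * fermionEmbed (PolySite.incl hΛ) (B k) -
        fermionEmbed (PolySite.incl hΛ) (B k) * pairSourceWindowHamiltonianTT' dWaveFormFactor Λ' tp U μ h)) =
        ∑ k ∈ s, (H * Γ' (fermionEmbed (PolySite.incl hΛ) (B k)) - Γ' (fermionEmbed (PolySite.incl hΛ) (B k)) * H) := by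
      rw [fermionEmbed_sum]
      refine Finset.sum_congr rfl fun k _ => ?_
      rw [hH, hΓ', dWaveSourceTorusTT'_commutator_fermionEmbed L hΛ h8 hInj tp U μ h (B k)]
    have h2 : Γ' (∑ l ∈ tt, (fermionEmbed (PolySite.incl (hsh l)) (fermionEmbed (PolySite.d4Emb (gam l) (v l) Λ) (Y l)) -
        fermionEmbed (PolySite.incl hΛ) (Y l))) = ∑ l ∈ tt, (Us l * Yt l * (Us l)ᴴ - Yt l) := by
      rw [fermionEmbed_sum]
      refine Finset.sum_congr rfl fun l _ => ?_
      rw [hUs, hYt, hΓΛ]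
      exact fermionEmbed_toTorusEmb_d4_sub hΛ (gam l) (v l) (hsh l) hInj' (Y l)
    have h3 : Γ' (∑ j ∈ uu, b j • ladderWord (cw j)) = ∑ j ∈ uu, (C j * W j - W j * C j) := by
      rw [fermionEmbed_sum]
      exact Finset.sum_congr rfl hcharged
    have h4 : Γ' (∑ m' ∈ ah, ((dc m' : ℝ) : ℂ) • ((V m')ᴴ - V m')) =
        ∑ m' ∈ ah, ((dc m' : ℝ) : ℂ) • ((Γ' (V m'))ᴴ - Γ' (V m')) := by
      rw [fermionEmbed_sum]
      refine Finset.sum_congr rfl fun m' _ => ?_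
      rw [fermionEmbed_smul, fermionEmbed_sub, hΓ', fermionEmbed_conjTranspose]
    have h5 : Γ' (∑ k ∈ w, a k • ladderWord (word k)) = ∑ k ∈ w, a k • M k := by
      rw [fermionEmbed_sum]
      refine Finset.sum_congr rfl fun k _ => ?_
      rw [fermionEmbed_smul, hM, fermionEmbed_ladderWord]
    rw [hX, key, fermionEmbed_add, fermionEmbed_add, fermionEmbed_add, fermionEmbed_add, fermionEmbed_add,
      fermionEmbed_add, hΓ', fermionEmbed_gramForm, ← hΓ', h1, h2, h3, h4, h5, hkkt]
  -- the local-certificate theorem in the tracial ground state of the full Fock space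
  have hmain := re_groundStateFunctional_ge_of_local_certificate_kkt hHh (Γ' Xw) X T hTH hTT hsum κ u hΛm
    (fun i => Γ' (O i)) s (fun k => Γ' (fermionEmbed (PolySite.incl hΛ) (B k))) tt Us Yt hU hUU
    uu C W hC1 hG Bt ah dc (fun m' => Γ' (V m')) w a M hMc htorus
  rw [card_torusSite] at hmain
  push_cast at hmain
  exact hmain

/-! ### The one-point response objective: `Re ω₀(Φ₀ + Φ₀†) = 2·m_L(h)` -/

/-- `Σ_v U_v P₀ U_vᴴ = Δ_d` (`U_v P₀ U_vᴴ = P_v`). [cite: Scalapino1995, §2 eq. (2.2)] -/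
theorem sum_conj_fockTranslate_localPair_zero (g : Site 2 → ℝ) :
    ∑ v : TorusSite 2 L, (fockTranslate v).val * localPair g L 0 * (fockTranslate v).valᴴ = pairField g L := by
  rw [pairField]
  refine Finset.sum_congr rfl fun v _ => ?_
  rw [← relabel_eq_fockRelabel_conj, relabel_translate_localPair, zero_add]

/-- **Translation invariance of the tracial ground state**: `ω₀(P₀) = ω₀(Δ_d)/L²`. [cite: BratteliRobinsonII1997, §6.2.4] -/
theorem groundStateFunctional_localPair_zero_eq_div (tp U μ h : ℝ) :
    (dWaveSourceTorusTT' L tp U μ h).groundStateFunctional (localPair dWaveFormFactor L 0) =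
      (dWaveSourceTorusTT' L tp U μ h).groundStateFunctional (pairField dWaveFormFactor L) /
        (Fintype.card (TorusSite 2 L) : ℂ) := by
  set T : TorusSite 2 L → Matrix (Finset (Orb (FermionTorus 2 L))) (Finset (Orb (FermionTorus 2 L))) ℂ :=
    fun v' => (fockTranslate v').val with hT
  have hTH : ∀ v', T v' * dWaveSourceTorusTT' L tp U μ h = dWaveSourceTorusTT' L tp U μ h * T v' :=
    fun v' => fockTranslate_mul_dWaveSourceTorusTT' L v' tp U μ h
  have hTT : ∀ v', (T v')ᴴ * T v' = 1 := fun v' => fockTranslate_conjTranspose_mul_self v'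
  have hsum : ∑ v', T v' * localPair dWaveFormFactor L 0 * (T v')ᴴ = pairField dWaveFormFactor L :=
    sum_conj_fockTranslate_localPair_zero dWaveFormFactor
  exact groundStateFunctional_eq_div_of_sum_conj (dWaveSourceTorusTT'_isHermitian L tp U μ h) T hTH hTT hsum

/-- Instance bridge: `dWaveSourceDensityTT'` (stated with the library instances) read under this section's
local `DecidableEq` instance (the instances agree by `Subsingleton.elim`). [cite: KomaTasaki1994, §1] -/
theorem dWaveSourceDensityTT'_eq_re_div (tp U μ h : ℝ) :
    dWaveSourceDensityTT' L tp U μ h =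
      ((dWaveSourceTorusTT' L tp U μ h).groundStateFunctional (pairField dWaveFormFactor L)).re / (L : ℝ) ^ 2 := by
  unfold dWaveSourceDensityTT'
  congr!

/-- **The local pair operator reads the pair density**: `Re ω₀(P₀ + P₀ᴴ) = 2 · dWaveSourceDensityTT' L tp U μ h`
(translation invariance, `Re ω₀(P₀ᴴ) = Re ω₀(P₀)`). [cite: KomaTasaki1994, §1] [cite: BratteliRobinsonII1997, §6.2.4] -/
theorem re_groundStateFunctional_localPair_add_conjTranspose (tp U μ h : ℝ) :
    ((dWaveSourceTorusTT' L tp U μ h).groundStateFunctional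
        (localPair dWaveFormFactor L 0 + (localPair dWaveFormFactor L 0)ᴴ)).re =
      2 * dWaveSourceDensityTT' L tp U μ h := by
  rw [map_add, Complex.add_re, Matrix.groundStateFunctional_conjTranspose_re,
    groundStateFunctional_localPair_zero_eq_div, card_torusSite, Complex.div_natCast_re,
    dWaveSourceDensityTT'_eq_re_div, Nat.cast_pow]
  ring

/-- The objective `Γ(incl) Φ₀ + (Γ(incl) Φ₀)ᴴ` pulled back to the torus is `P₀ + P₀ᴴ`.
[cite: KomaTasaki1994, §1] -/
theorem fermionEmbed_toTorusEmb_localPairAt_add_conjTranspose {Λ' : Finset (Site 2)}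
    (hP : pairRegion (insert (0 : Site 2) unitSteps) 0 ⊆ Λ') (hInj' : Set.InjOn (Torus.proj (d := 2) L) ↑Λ') :
    fermionEmbed (PolySite.toTorusEmb L hInj')
        (fermionEmbed (PolySite.incl hP) (localPairAt (insert (0 : Site 2) unitSteps) dWaveFormFactor 0) +
          (fermionEmbed (PolySite.incl hP) (localPairAt (insert (0 : Site 2) unitSteps) dWaveFormFactor 0))ᴴ) =
      localPair dWaveFormFactor L 0 + (localPair dWaveFormFactor L 0)ᴴ := by
  have hproj0 : Torus.proj L (0 : Site 2) = 0 := by funext i; simp [Torus.proj]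
  rw [fermionEmbed_add, fermionEmbed_conjTranspose, fermionEmbed_toTorusEmb_incl hP hInj',
    fermionEmbed_toTorusEmb_localPairAt, localPairOn_insert_zero_unitSteps, hproj0]

/-- **Window certificate with a KKT block ⇒ sourced one-point response FLOOR on every large torus**: with
the objective `X = Γ(incl) Φ₀ + (Γ(incl) Φ₀)ᴴ`, for every `L ≥ 3` with `x ↦ x mod L` injective on
`thicken Λ' 1`: `c − Σₖ ‖aₖ‖ + κ (u − E₀(A_L)/L²) ≤ 2 · dWaveSourceDensityTT' L tp U μ h` (a finite-`h`
response floor, not an order parameter). [cite: WangEtAl2024, §III] [cite: KomaTasaki1994, §1] -/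
theorem two_mul_dWaveSourceDensityTT'_ge_of_window_certificate_kkt_d4 (tp U μ h : ℝ) (hL : 3 ≤ L)
    {Λ Λ' : Finset (Site 2)} (hΛ : Λ ⊆ Λ') (h8 : thicken Λ 1 ⊆ Λ')
    (h0 : thicken ({0} : Finset (Site 2)) 1 ⊆ Λ') (hz : (0 : Site 2) ∈ Λ')
    (hP : pairRegion (insert (0 : Site 2) unitSteps) 0 ⊆ Λ')
    (hInj : Set.InjOn (Torus.proj (d := 2) L) ↑(thicken Λ' 1)) (κ u : ℝ)
    {m : Type*} [Fintype m] [DecidableEq m] {Λm : Matrix m m ℂ} (hΛm : Λm.PosSemidef)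
    (O : m → FermionOp Λ')
    {κ' : Type*} (s : Finset κ') (B : κ' → FermionOp Λ)
    {ι : Type*} (tt : Finset ι) (gam : ι → DihedralGroup 4) (v : ι → Site 2)
    (hgam : ∀ l ∈ tt, b1gChar (gam l) = 1) (hsh : ∀ l, d4ShiftSet (gam l) (v l) Λ ⊆ Λ') (Y : ι → FermionOp Λ)
    {χ : Type*} (uu : Finset χ) (b : χ → ℂ) (cw : χ → List (Orb (PolySite Λ') × Bool))
    (hcw : ∀ j ∈ uu, ladderSpinCharge (cw j) ≠ 0)
    {β : Type*} [Fintype β] [DecidableEq β] {G : Matrix β β ℂ} (hG : G.PosSemidef) (Bk : β → FermionOp Λ)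
    {δ : Type*} (ah : Finset δ) (dc : δ → ℝ) (V : δ → FermionOp Λ')
    {κ'' : Type*} (w : Finset κ'') (a : κ'' → ℂ) (word : κ'' → List (Orb (PolySite Λ') × Bool)) {c : ℝ}
    (hcert : (fermionEmbed (PolySite.incl hP) (localPairAt (insert (0 : Site 2) unitSteps) dWaveFormFactor 0) +
          (fermionEmbed (PolySite.incl hP) (localPairAt (insert (0 : Site 2) unitSteps) dWaveFormFactor 0))ᴴ) -
        (c : ℂ) • (1 : FermionOp Λ') -
        ((κ : ℝ) : ℂ) • (((u : ℝ) : ℂ) • (1 : FermionOp Λ') -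
          (fermionEmbed (PolySite.incl h0) ((hubbardTTPrimeFermionInteraction 1 tp U).meanEnergyObs 1) -
            (μ : ℂ) • ∑ σ : Fin 2, nAt 0 hz σ -
            (h : ℂ) • (fermionEmbed (PolySite.incl hP) (localPairAt (insert (0 : Site 2) unitSteps) dWaveFormFactor 0) +
              (fermionEmbed (PolySite.incl hP) (localPairAt (insert (0 : Site 2) unitSteps) dWaveFormFactor 0))ᴴ))) =
      gramForm Λm O +
        (∑ k ∈ s, (pairSourceWindowHamiltonianTT' dWaveFormFactor Λ' tp U μ h * fermionEmbed (PolySite.incl hΛ) (B k) -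
            fermionEmbed (PolySite.incl hΛ) (B k) * pairSourceWindowHamiltonianTT' dWaveFormFactor Λ' tp U μ h) +
          ∑ l ∈ tt, (fermionEmbed (PolySite.incl (hsh l)) (fermionEmbed (PolySite.d4Emb (gam l) (v l) Λ) (Y l)) -
            fermionEmbed (PolySite.incl hΛ) (Y l)) +
          ∑ j ∈ uu, b j • ladderWord (cw j)) +
        (kktForm (pairSourceWindowHamiltonianTT' dWaveFormFactor Λ' tp U μ h) G
            (fun i => fermionEmbed (PolySite.incl hΛ) (Bk i)) +
          (∑ m' ∈ ah, ((dc m' : ℝ) : ℂ) • ((V m')ᴴ - V m') + ∑ k ∈ w, a k • ladderWord (word k)))) :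
    c - ∑ k ∈ w, ‖a k‖ + κ * (u - (dWaveSourceTorusTT' L tp U μ h).groundEnergy / (L : ℝ) ^ 2) ≤
      2 * dWaveSourceDensityTT' L tp U μ h := by
  have hInj' : Set.InjOn (Torus.proj (d := 2) L) ↑Λ' := hInj.mono (by exact_mod_cast subset_thicken Λ' 1)
  have hmain := re_groundStateFunctional_ge_of_sourced_window_certificate_kkt_d4_TT' tp U μ h hL hΛ h8 h0 hz hP
    hInj hInj' _ κ u hΛm O s B tt gam v hgam hsh Y uu b cw hcw hG Bk ah dc V w a word hcert
  rwa [fermionEmbed_toTorusEmb_localPairAt_add_conjTranspose hP hInj',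
    re_groundStateFunctional_localPair_add_conjTranspose] at hmain

end Certificate

/-! ### Eventual form (library instances), the `∀ L ≥ L₀` shape of a response-floor row -/

/-- **Eventual form**: the window data of `two_mul_dWaveSourceDensityTT'_ge_of_window_certificate_kkt_d4`
(one identity, independent of `L`), `κ ≥ 0` and a sourced energy CAP on all large tori (`E₀(A_L) ≤ u·L²` for
`L ≥ L₁`; any true cap will do when `κ = 0`) give `L₀` with `(c − Σₖ ‖aₖ‖)/2 ≤ dWaveSourceDensityTT' L tp U μ h`
for every `L ≥ L₀` — a certified finite-`h` RESPONSE FLOOR uniform in the volume (the `PinFieldResponseFloorAt`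
row shape), stated with the library instances. [cite: WangEtAl2024, §III] [cite: KomaTasaki1994, §1] -/
theorem dWaveSourceDensityTT'_ge_of_window_certificate_kkt_d4_eventually (tp U μ h : ℝ)
    {Λ Λ' : Finset (Site 2)} (hΛ : Λ ⊆ Λ') (h8 : thicken Λ 1 ⊆ Λ')
    (h0 : thicken ({0} : Finset (Site 2)) 1 ⊆ Λ') (hz : (0 : Site 2) ∈ Λ')
    (hP : pairRegion (insert (0 : Site 2) unitSteps) 0 ⊆ Λ') {κ u : ℝ} (hκ : 0 ≤ κ) {L₁ : ℕ}
    (hu : ∀ (L : ℕ) [NeZero L], L₁ ≤ L → (dWaveSourceTorusTT' L tp U μ h).groundEnergy ≤ u * (L : ℝ) ^ 2)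
    {m : Type*} [Fintype m] [DecidableEq m] {Λm : Matrix m m ℂ} (hΛm : Λm.PosSemidef)
    (O : m → FermionOp Λ')
    {κ' : Type*} (s : Finset κ') (B : κ' → FermionOp Λ)
    {ι : Type*} (tt : Finset ι) (gam : ι → DihedralGroup 4) (v : ι → Site 2)
    (hgam : ∀ l ∈ tt, b1gChar (gam l) = 1) (hsh : ∀ l, d4ShiftSet (gam l) (v l) Λ ⊆ Λ') (Y : ι → FermionOp Λ)
    {χ : Type*} (uu : Finset χ) (b : χ → ℂ) (cw : χ → List (Orb (PolySite Λ') × Bool))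
    (hcw : ∀ j ∈ uu, ladderSpinCharge (cw j) ≠ 0)
    {β : Type*} [Fintype β] [DecidableEq β] {G : Matrix β β ℂ} (hG : G.PosSemidef) (Bk : β → FermionOp Λ)
    {δ : Type*} (ah : Finset δ) (dc : δ → ℝ) (V : δ → FermionOp Λ')
    {κ'' : Type*} (w : Finset κ'') (a : κ'' → ℂ) (word : κ'' → List (Orb (PolySite Λ') × Bool)) {c : ℝ}
    (hcert : (fermionEmbed (PolySite.incl hP) (localPairAt (insert (0 : Site 2) unitSteps) dWaveFormFactor 0) +
          (fermionEmbed (PolySite.incl hP) (localPairAt (insert (0 : Site 2) unitSteps) dWaveFormFactor 0))ᴴ) -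
        (c : ℂ) • (1 : FermionOp Λ') -
        ((κ : ℝ) : ℂ) • (((u : ℝ) : ℂ) • (1 : FermionOp Λ') -
          (fermionEmbed (PolySite.incl h0) ((hubbardTTPrimeFermionInteraction 1 tp U).meanEnergyObs 1) -
            (μ : ℂ) • ∑ σ : Fin 2, nAt 0 hz σ -
            (h : ℂ) • (fermionEmbed (PolySite.incl hP) (localPairAt (insert (0 : Site 2) unitSteps) dWaveFormFactor 0) +
              (fermionEmbed (PolySite.incl hP) (localPairAt (insert (0 : Site 2) unitSteps) dWaveFormFactor 0))ᴴ))) =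
      gramForm Λm O +
        (∑ k ∈ s, (pairSourceWindowHamiltonianTT' dWaveFormFactor Λ' tp U μ h * fermionEmbed (PolySite.incl hΛ) (B k) -
            fermionEmbed (PolySite.incl hΛ) (B k) * pairSourceWindowHamiltonianTT' dWaveFormFactor Λ' tp U μ h) +
          ∑ l ∈ tt, (fermionEmbed (PolySite.incl (hsh l)) (fermionEmbed (PolySite.d4Emb (gam l) (v l) Λ) (Y l)) -
            fermionEmbed (PolySite.incl hΛ) (Y l)) +
          ∑ j ∈ uu, b j • ladderWord (cw j)) +
        (kktForm (pairSourceWindowHamiltonianTT' dWaveFormFactor Λ' tp U μ h) G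
            (fun i => fermionEmbed (PolySite.incl hΛ) (Bk i)) +
          (∑ m' ∈ ah, ((dc m' : ℝ) : ℂ) • ((V m')ᴴ - V m') + ∑ k ∈ w, a k • ladderWord (word k)))) :
    ∃ L₀ : ℕ, ∀ (L : ℕ) [NeZero L], L₀ ≤ L →
      (c - ∑ k ∈ w, ‖a k‖) / 2 ≤ dWaveSourceDensityTT' L tp U μ h := by
  obtain ⟨L₂, hL₂⟩ := exists_forall_le_injOn_proj (thicken Λ' 1)
  refine ⟨max (max 3 L₁) L₂, fun L _ hL => ?_⟩
  have h3 : 3 ≤ L := le_trans (le_trans (le_max_left _ _) (le_max_left _ _)) hL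
  have h1 : L₁ ≤ L := le_trans (le_trans (le_max_right _ _) (le_max_left _ _)) hL
  have h2 : L₂ ≤ L := le_trans (le_max_right _ _) hL
  -- the torus theorem is stated under the torus files' local `DecidableEq` instance; `convert` crosses to the
  -- library instances of this statement (the instances agree by `Subsingleton.elim`)
  have hmain : c - ∑ k ∈ w, ‖a k‖ + κ * (u - (dWaveSourceTorusTT' L tp U μ h).groundEnergy / (L : ℝ) ^ 2) ≤
      2 * dWaveSourceDensityTT' L tp U μ h := by
    convert two_mul_dWaveSourceDensityTT'_ge_of_window_certificate_kkt_d4 tp U μ h h3 hΛ h8 h0 hz hP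
      (hL₂ L h2) κ u hΛm O s B tt gam v hgam hsh Y uu b cw hcw hG Bk ah dc V w a word hcert
  have hL2 : (0 : ℝ) < (L : ℝ) ^ 2 := by
    have : (0 : ℝ) < (L : ℝ) := by exact_mod_cast Nat.pos_of_ne_zero (NeZero.ne L)
    positivity
  have hu' : (dWaveSourceTorusTT' L tp U μ h).groundEnergy / (L : ℝ) ^ 2 ≤ u := by
    rw [div_le_iff₀ hL2]; exact hu L h1
  have hslack : 0 ≤ κ * (u - (dWaveSourceTorusTT' L tp U μ h).groundEnergy / (L : ℝ) ^ 2) :=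
    mul_nonneg hκ (sub_nonneg.2 hu')
  rw [div_le_iff₀ (by norm_num : (0 : ℝ) < 2)]
  linarith

end Literature.MathematicalPhysics.QuantumLattice
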